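import Mathlib.GroupTheory.PGroup
import Mathlib.GroupTheory.Perm.Support
import Mathlib.Data.Finsupp.Basic
import Mathlib.Algebra.BigOperators.Finsupp.Basic
import Mathlib.Data.ZMod.Basic
import Mathlib.Logic.Relation
import HarnessLib

/-!
# Invariant 1-chains modulo `q` under an automorphism of `q`-power order: a weighted fixed-point count

Topic `Literature/GroupTheory/CombinatorialGroupTheory`; theorems only (no definitions).  This file is
the purely combinatorial core («brick T-a») of an elementary finite-quotient argument separating the
conjugacy classes of TORSION elements in amalgamated free products of finite groups (J. L. Dyer,
*Separating conjugates in amalgamated free products and HNN extensions*, J. Austral. Math. Soc. (A) 29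
(1980), Thm. 4, Cases 1–2 of the proof p.41, where the finite-level statement is imported from Dyer 1979;
here the finite level is obtained instead from a homology count on the finite quotient graphs of the
Bass–Serre tree, for which this file supplies the counting step).

**Setting.**  An (oriented) graph is given by two maps `hd tl : E → V`; a pair of permutations
`τV : Perm V`, `τE : Perm E` acts compatibly (`hd (τE e) = τV (hd e)`, `tl (τE e) = τV (tl e)`);
`τE` has `q`-power order (`τE ^ (q ^ a) = 1`, `q` prime).  A 1-chain with coefficients in `ZMod q` is a
finitely supported `c : E →₀ ZMod q`; its boundary is `∂c = c.mapDomain hd - c.mapDomain tl`.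

* `sum_eq_sum_filter_mem_fixedPoints_of_isPGroup` — **weighted fixed-point congruence**: for a finite
  `p`-group `G` acting on `X`, a `G`-stable finite set `s` and a `G`-invariant `F : X → ZMod p`,
  `∑_{x ∈ s} F x = ∑_{x ∈ s, x fixed} F x` (the weighted form of `|X| ≡ |X^G| (mod p)`,
  Mathlib `IsPGroup.card_modEq_card_fixedPoints`).
* `reflTransGen_fixedEdge_of_invariant_chain` — **the counting step**: if `c` is `τE`-invariant,
  `τV w = w`, and `∂c = [v₀] - [w]`, then `w` and `v₀` are joined by a path of `τE`-FIXED edges.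
  (Proof: the indicator `λ` of the fixed-edge component `S` of `w` is `τV`-invariant; `λ(∂c)` equals
  `λ v₀ - 1` by hypothesis and, regrouping the edge sum into `⟨τE⟩`-orbits, equals the sum over the
  `τE`-fixed edges, each of which contributes `0` because its endpoints are both in or both outside `S`.)

No published source states these lemmas in this form; the graph-theoretic mechanism (fixed points of a
`q`-group on the fibres of the mod-`q` homology cover) is standard Smith-theory-style counting.  They are
used by the sequel files of the route note `B6TOR-ROUTE.md` (cell abc-iut, F-2732 brick programme).

## References

* J. L. Dyer, *Separating conjugates in amalgamated free products and HNN extensions*, J. Austral. Math.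
  Soc. Ser. A 29 (1980) 35–51, Thm. 4. [Dyer1980]
-/

namespace Literature.GroupTheory.CombinatorialGroupTheory

namespace InvariantChains

open MulAction Finset

open scoped Classical in
/-- **Weighted fixed-point congruence for `p`-groups.**  Let a `p`-group `G` (with `G` finite) act on
`X`, let `s` be a finite `G`-stable set and `F : X → ZMod p` a `G`-invariant function.  Then
`∑_{x ∈ s} F x = ∑_{x ∈ s ∩ X^G} F x` in `ZMod p`: the non-trivial orbits have cardinality divisible by
`p` and `F` is constant on them.  (Weighted form of Mathlib's `IsPGroup.card_modEq_card_fixedPoints`.)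
PROVENANCE: a standard counting fact, recorded here as a step of OUR proof of the finite level of
Dyer's theorem «amalgams of two finite groups are conjugacy separable» (the statement below is not
printed in the cited source, which imports that finite level from Dyer 1979).
[cite: Dyer1980, Thm 1 (finite amalgams c.s.) — proof device, weighted fixed-point count] -/
theorem sum_eq_sum_filter_mem_fixedPoints_of_isPGroup {p : ℕ} [hp : Fact p.Prime] {G X : Type*}
    [Group G] [MulAction G X] [Finite G] (hG : IsPGroup p G) (F : X → ZMod p)
    (hF : ∀ (g : G) (x : X), F (g • x) = F x) :
    ∀ (s : Finset X), (∀ (g : G), ∀ x ∈ s, g • x ∈ s) →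
      ∑ x ∈ s, F x = ∑ x ∈ s with x ∈ fixedPoints G X, F x := by
  classical
  intro s
  induction s using Finset.strongInduction with
  | H s ih =>
    intro hs
    by_cases hall : ∀ x ∈ s, x ∈ fixedPoints G X
    · rw [Finset.filter_true_of_mem hall]
    push Not at hall
    obtain ⟨x, hxs, hx⟩ := hall
    -- the orbit of `x`, as a sub-finset of `s`
    set O : Finset X := s.filter (fun y => y ∈ orbit G x) with hO
    have hOsub : O ⊆ s := Finset.filter_subset _ _
    have hxO : x ∈ O := Finset.mem_filter.2 ⟨hxs, mem_orbit_self x⟩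
    have hOorbit : ∀ y, y ∈ O ↔ y ∈ orbit G x := by
      intro y
      refine ⟨fun hy => (Finset.mem_filter.1 hy).2, fun hy => Finset.mem_filter.2 ⟨?_, hy⟩⟩
      obtain ⟨g, rfl⟩ := mem_orbit_iff.1 hy
      exact hs g x hxs
    -- split the sum
    have hsplit : ∑ y ∈ s, F y = ∑ y ∈ O, F y + ∑ y ∈ s \ O, F y := by
      rw [← Finset.sum_union (Finset.disjoint_sdiff), Finset.union_sdiff_of_subset hOsub]
    -- the orbit sum vanishes: `F` is constant on `O` and `|O| = p ^ n` with `n ≥ 1`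
    have hconst : ∀ y ∈ O, F y = F x := by
      intro y hy
      obtain ⟨g, rfl⟩ := mem_orbit_iff.1 ((hOorbit y).1 hy)
      exact hF g x
    have hOcard : O.card = Nat.card (orbit G x) := by
      rw [← Nat.card_eq_finsetCard]
      refine Nat.card_congr (Equiv.subtypeEquivRight ?_)
      intro y
      exact hOorbit y
    haveI : Finite (orbit G x) := by
      unfold MulAction.orbit; infer_instance
    obtain ⟨n, hn⟩ := hG.card_orbit x
    have hn0 : n ≠ 0 := by
      rintro rfl
      rw [pow_zero] at hn
      apply hx
      haveI : Fintype (orbit G x) := Fintype.ofFinite _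
      rw [mem_fixedPoints_iff_card_orbit_eq_one, ← Nat.card_eq_fintype_card]
      exact hn
    have hOsum : ∑ y ∈ O, F y = 0 := by
      rw [Finset.sum_congr rfl hconst, Finset.sum_const, hOcard, hn, nsmul_eq_mul]
      have : ((p ^ n : ℕ) : ZMod p) = 0 := by
        rw [Nat.cast_pow, ZMod.natCast_self, zero_pow hn0]
      rw [this, zero_mul]
    -- the complement is stable, smaller, and has the same fixed points
    have hstab : ∀ (g : G), ∀ y ∈ s \ O, g • y ∈ s \ O := by
      intro g y hy
      rw [Finset.mem_sdiff] at hy ⊢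
      refine ⟨hs g y hy.1, fun h => hy.2 ?_⟩
      rw [hOorbit] at h ⊢
      rw [← orbit_eq_iff] at h ⊢
      rwa [orbit_smul] at h
    have hlt : s \ O ⊂ s := Finset.sdiff_ssubset hOsub ⟨x, hxO⟩
    rw [hsplit, hOsum, zero_add, ih _ hlt hstab]
    -- fixed points of `s` all lie outside `O`
    refine Finset.sum_congr ?_ (fun _ _ => rfl)
    ext y
    simp only [Finset.mem_filter, Finset.mem_sdiff]
    constructor
    · rintro ⟨⟨hy, -⟩, hfix⟩; exact ⟨hy, hfix⟩
    · rintro ⟨hy, hfix⟩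
      refine ⟨⟨hy, fun hyO => hx ?_⟩, hfix⟩
      obtain ⟨g, rfl⟩ := mem_orbit_iff.1 ((hOorbit y).1 hyO)
      have hgx : g⁻¹ • g • x = g • x := mem_fixedPoints.1 hfix g⁻¹
      rw [inv_smul_smul] at hgx
      rw [hgx]; exact hfix

/-- **The counting step.**  Let `hd tl : E → V` be a graph with a compatible pair of permutations
`τV`, `τE`, where `τE` has `q`-power order (`q` prime).  Let `c : E →₀ ZMod q` be a `τE`-invariant
1-chain whose boundary `c.mapDomain hd - c.mapDomain tl` is `[v₀] - [w]` for a `τV`-fixed vertex `w`.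
Then `w` is joined to `v₀` by a path of `τE`-fixed edges (traversed in either direction).
PROVENANCE: this is the counting step of OUR proof of the torsion–torsion case of Dyer's theorem
«amalgams of two finite groups are conjugacy separable» (route note B6TOR-ROUTE.md §2 (d), cell
abc-iut); the statement is not printed in the cited source, which imports the finite level from
Dyer 1979 (J. London Math. Soc. (2) 20), and is tagged with the theorem it serves.
[cite: Dyer1980, Thm 1 (finite amalgams c.s.) — proof device, counting step] -/
theorem reflTransGen_fixedEdge_of_invariant_chain {V E : Type*} (hd tl : E → V)
    (τV : Equiv.Perm V) (τE : Equiv.Perm E)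
    (hhd : ∀ e, hd (τE e) = τV (hd e)) (htl : ∀ e, tl (τE e) = τV (tl e))
    {q : ℕ} [hq : Fact q.Prime] {a : ℕ} (hτ : τE ^ (q ^ a) = 1)
    (c : E →₀ ZMod q) (hc : ∀ e, c (τE e) = c e) {v₀ w : V} (hw : τV w = w)
    (hbd : c.mapDomain hd - c.mapDomain tl = Finsupp.single v₀ 1 - Finsupp.single w 1) :
    Relation.ReflTransGen
      (fun u u' : V => ∃ e : E, τE e = e ∧ (tl e = u ∧ hd e = u' ∨ hd e = u ∧ tl e = u')) w v₀ := by
  classical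
  -- the fixed-edge relation and the component `S` of `w`
  set R : V → V → Prop :=
    fun u u' => ∃ e : E, τE e = e ∧ (tl e = u ∧ hd e = u' ∨ hd e = u ∧ tl e = u') with hR
  let S : Set V := {u | Relation.ReflTransGen R w u}
  have hwS : w ∈ S := Relation.ReflTransGen.refl
  -- every vertex of `S` is `τV`-fixed
  have hSfix : ∀ u ∈ S, τV u = u := by
    intro u hu
    induction hu with
    | refl => exact hw
    | tail _ huv _ =>
      obtain ⟨e, he, h⟩ := huv
      rcases h with ⟨-, rfl⟩ | ⟨-, rfl⟩
      · rw [← hhd, he]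
      · rw [← htl, he]
  -- hence `S` is `τV`-invariant
  have hSinv : ∀ u, τV u ∈ S ↔ u ∈ S := by
    intro u
    constructor
    · intro h
      have h1 : τV (τV u) = τV u := hSfix _ h
      have e := τV.injective h1
      rw [e] at h; exact h
    · intro h; rw [hSfix u h]; exact h
  -- the indicator of `S`
  let lam : V → ZMod q := fun u => if u ∈ S then 1 else 0
  have hlam : ∀ u, lam (τV u) = lam u := by
    intro u; simp only [lam, hSinv]
  -- a fixed edge has both or neither endpoint in `S`
  have hedge : ∀ e, τE e = e → lam (hd e) = lam (tl e) := by
    intro e he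
    have h1 : tl e ∈ S → hd e ∈ S := fun h => Relation.ReflTransGen.tail h ⟨e, he, Or.inl ⟨rfl, rfl⟩⟩
    have h2 : hd e ∈ S → tl e ∈ S := fun h => Relation.ReflTransGen.tail h ⟨e, he, Or.inr ⟨rfl, rfl⟩⟩
    by_cases h : tl e ∈ S
    · simp only [lam, if_pos h, if_pos (h1 h)]
    · simp only [lam, if_neg h, if_neg (fun h' => h (h2 h'))]
  -- the linear functional `L f = ∑ f u * lam u`
  let L : (V →₀ ZMod q) → ZMod q := fun f => f.sum fun u r => r * lam u
  have hL_add : ∀ f g : V →₀ ZMod q, L (f + g) = L f + L g := by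
    intro f g
    exact Finsupp.sum_add_index' (fun u => by simp) (fun u r r' => by simp [add_mul])
  have hL_neg : ∀ f : V →₀ ZMod q, L (-f) = -L f := by
    intro f
    have h0 := hL_add f (-f)
    rw [add_neg_cancel] at h0
    have : L 0 = 0 := by simp [L]
    rw [this] at h0
    exact (neg_eq_of_add_eq_zero_right h0.symm).symm
  have hL_sub : ∀ f g : V →₀ ZMod q, L (f - g) = L f - L g := by
    intro f g; rw [sub_eq_add_neg, hL_add, hL_neg, ← sub_eq_add_neg]
  have hL_single : ∀ (u : V) (r : ZMod q), L (Finsupp.single u r) = r * lam u := by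
    intro u r; simp [L, Finsupp.sum_single_index]
  have hL_map : ∀ (f : E → V), L (c.mapDomain f) = c.sum fun e r => r * lam (f e) := by
    intro f
    exact Finsupp.sum_mapDomain_index (fun u => by simp) (fun u r r' => by simp [add_mul])
  -- evaluate `L` on both sides of the boundary identity
  have hval := congrArg L hbd
  rw [hL_sub, hL_sub, hL_single, hL_single, hL_map, hL_map, one_mul, one_mul] at hval
  have hlamw : lam w = 1 := if_pos hwS
  rw [hlamw] at hval
  -- the left-hand side is a sum over `c.support` of a `τE`-invariant function
  let F : E → ZMod q := fun e => c e * (lam (hd e) - lam (tl e))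
  have hLHS : (c.sum fun e r => r * lam (hd e)) - (c.sum fun e r => r * lam (tl e))
      = ∑ e ∈ c.support, F e := by
    simp only [Finsupp.sum, F, mul_sub, Finset.sum_sub_distrib]
  rw [hLHS] at hval
  -- the cyclic group generated by `τE` is a finite `q`-group acting on `E`
  let Gτ : Subgroup (Equiv.Perm E) := Subgroup.zpowers τE
  have hfin : IsOfFinOrder τE := isOfFinOrder_iff_pow_eq_one.2 ⟨q ^ a, pow_pos hq.out.pos _, hτ⟩
  haveI : Finite Gτ := Finite.of_equiv _ (finEquivZPowers hfin)
  have hPG : IsPGroup q Gτ := by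
    intro g
    refine ⟨a, ?_⟩
    obtain ⟨k, hk⟩ := Subgroup.mem_zpowers_iff.1 g.2
    apply Subtype.ext
    change (g : Equiv.Perm E) ^ (q ^ a) = 1
    rw [← hk, ← zpow_natCast, ← zpow_mul, mul_comm, zpow_mul, zpow_natCast, hτ, one_zpow]
  have hF : ∀ (g : Gτ) (e : E), F (g • e) = F e := by
    have key : ∀ e, F (τE e) = F e := by
      intro e; simp only [F, hc, hhd, htl, hlam]
    intro g e
    obtain ⟨k, hk⟩ := Subgroup.mem_zpowers_iff.1 g.2
    change F ((g : Equiv.Perm E) e) = F e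
    rw [← hk]
    -- invariance under all integer powers
    have hnat : ∀ (n : ℕ) (e : E), F ((τE ^ n) e) = F e := by
      intro n
      induction n with
      | zero => intro e; simp
      | succ n ihn => intro e; rw [pow_succ, Equiv.Perm.mul_apply, ihn, key]
    cases k with
    | ofNat n => simpa using hnat n e
    | negSucc n =>
      have h := hnat (n + 1) ((τE ^ (Int.negSucc n)) e)
      rw [← Equiv.Perm.mul_apply, zpow_negSucc, mul_inv_cancel, Equiv.Perm.one_apply] at h
      exact h.symm
  have hstab : ∀ (g : Gτ), ∀ e ∈ c.support, g • e ∈ c.support := by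
    have key : ∀ e, e ∈ c.support → τE e ∈ c.support := by
      intro e he; rw [Finsupp.mem_support_iff] at he ⊢; rwa [hc]
    have hnat : ∀ (n : ℕ), ∀ e ∈ c.support, (τE ^ n) e ∈ c.support := by
      intro n
      induction n with
      | zero => intro e he; simpa using he
      | succ n ihn => intro e he; rw [pow_succ, Equiv.Perm.mul_apply]; exact ihn _ (key e he)
    intro g e he
    obtain ⟨k, hk⟩ := Subgroup.mem_zpowers_iff.1 g.2
    change (g : Equiv.Perm E) e ∈ c.support
    rw [← hk]
    cases k with
    | ofNat n => simpa using hnat n e he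
    | negSucc n =>
      -- `τE ^ (-(n+1)) = (τE ^ (n+1))⁻¹`, and a power of `τE⁻¹` is a positive power of `τE`
      -- because `τE` has finite order
      obtain ⟨m, hm⟩ : ∃ m : ℕ, τE ^ (Int.negSucc n) = τE ^ m := by
        have hmem : τE ^ (Int.negSucc n) ∈ Submonoid.powers τE := by
          rw [hfin.mem_powers_iff_mem_zpowers]; exact ⟨Int.negSucc n, rfl⟩
        obtain ⟨m, hm⟩ := hmem
        exact ⟨m, hm.symm⟩
      rw [hm]; exact hnat m e he
  -- apply the weighted fixed-point congruence
  have hsum := sum_eq_sum_filter_mem_fixedPoints_of_isPGroup hPG F hF c.support hstab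
  have hzero : ∑ e ∈ c.support with e ∈ fixedPoints Gτ E, F e = 0 := by
    refine Finset.sum_eq_zero ?_
    intro e he
    rw [Finset.mem_filter] at he
    have hfix : τE e = e := by
      have := (mem_fixedPoints.1 he.2) ⟨τE, Subgroup.mem_zpowers τE⟩
      exact this
    simp only [F, hedge e hfix, sub_self, mul_zero]
  rw [hsum, hzero] at hval
  -- so `lam v₀ = 1`, i.e. `v₀ ∈ S`
  have hv₀ : v₀ ∈ S := by
    by_contra h
    have : lam v₀ = 0 := if_neg h
    rw [this] at hval
    exact one_ne_zero (sub_eq_zero.1 hval.symm).symm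
  exact hv₀

end InvariantChains

end Literature.GroupTheory.CombinatorialGroupTheory
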